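import Literature.NumberTheory.EllipticCurves.LambdaAdicSelmerDataToEisensteinH1
import Literature.NumberTheory.EllipticCurves.ZpExtensionEisensteinTwistCoeffActionProofs
import Mathlib.RingTheory.PowerSeries.Trunc
import HarnessLib

/-!
# The compact control map `𝔖_p(K_∞) → H¹(K, T_𝔮)` is `Λ`-linear (proofs + the bundled `Λ`-linear map)

Topic `NumberTheory/EllipticCurves` (sequel of `LambdaAdicSelmerDataToEisensteinH1`). Setting as there: `E = V`
elliptic over a number field `K`, `E(K)[p] = 0`, `κ : ZpExtension K p` with topological generator `γ`,
`D : V.LambdaAdicSelmerData κ γ` (`𝔖 = 𝔖_p(K_∞)`, `T ↦ conj_γ − 1`, `C c ↦ (c mod p^k)` levelwise, continuity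
`proj_cont`), `κ⁻ = κ.unitTwist (-1)`, the level components `eisensteinComponent D hm k n hn : 𝔖 → H¹(K, E[p^k] ⊗ A_{m,k}(ψ⁻¹))`
and their lift `toEisensteinH1 D hm t ht I hγ hE : 𝔖 →+ I.H` to the pinned `H¹(K, T_𝔮)` (`I : EisensteinH1Data κ⁻ …`).

* §1 the components intertwine the `Λ`-actions: `eisensteinComponent_X_smul` (`T`: `proj_X` on `𝔖`, the
  dictionary `coresEisenstein_conjMap_of_layerIndex_eq_neg_one` at `κ̄⁻_J(γ) = −1`, and `[T] ↦ (1+T)• − id`),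
  `eisensteinComponent_C_smul` (constants: `proj_C` and `[C c] ↦ (c mod p^k)•`), `eisensteinComponent_smul_eq_zero_of_forall_coeff_eq_zero`
  (`proj_cont`), `eisensteinComponent_coe_smul` (polynomials, by induction), and **`eisensteinComponent_smul`**: for EVERY
  `g ∈ Λ` and every layer `n ≥ J_k` with `m ≤ p^n`, `comp (g • s) = H¹([g] •) (comp s)` (truncation `g = g_{<kp^n} + g_{≥kp^n}`,
  Mathlib `PowerSeries.trunc`; the tail acts by `0` on both sides: `proj_cont` on `𝔖`, `X^{mk} ∈ (q_m, p^k)` on `A_{m,k}`).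
* §2 **`toEisensteinH1_smul`**: `toEisensteinH1 (g • s) = g • toEisensteinH1 s` (`EisensteinH1Data.proj_smul` + `ext`), and the
  bundled **`toEisensteinH1Linear D hm t ht I hγ hE : D.S →ₗ[Λ] I.H`** with `proj_toEisensteinH1Linear` — Howard's map
  `𝔖 = H¹(K, 𝐓) → H¹(K, T_𝔮)` of `Λ`-modules [Howard 2004, §2.2, Lemma 2.2.7 / Prop. 2.2.8 at `𝔮 = T^m + p`], the compact
  control map `f` of the cell's `SpecWitness` before restriction to Selmer parts and before any kernel/cokernel bound.

THEOREMS + one bundled definition; no named fact, no instance, no `sorry`. Cell `pub/bsd-print-x9`, D1 road of the shared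
μ-residual of rows 9/10. BSD is not proved by any of this.

References: [Howard2004HeegnerKolyvagin] B. Howard, Compositio Math. 140 (2004), §2.2, Def. 2.2.3, Lemma 2.2.7, Prop. 2.2.8,
proof of Thm. 2.2.10; [PerrinRiou1987BSMF] §0 pp. 401–402; [Washington1997] §7.1, §13.1–§13.2; [SerreGaloisCohomology1997] I §2.
-/

noncomputable section

open scoped Topology Classical ContRepresentation
open Field CategoryTheory

universe u

namespace WeierstrassCurve.LambdaAdicSelmerData

open Literature.NumberTheory.EllipticCurves Literature.NumberTheory.GaloisRepresentations
open Literature.NumberTheory.EllipticCurves.ZpExtension (eisensteinLevel)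

variable {K : Type u} [Field K] [NumberField K] {V : WeierstrassCurve K} [V.IsElliptic] {p : ℕ} [hp : Fact p.Prime]
  {κ : ZpExtension K p} {γ : absoluteGaloisGroup K} (D : V.LambdaAdicSelmerData κ γ) {m : ℕ} (hm : 1 ≤ m)

/-! ## §1 The level components intertwine the `Λ`-actions -/

omit [V.IsElliptic] in
/-- **`T` on `𝔖` ↔ `[T]` on `H¹`**: `comp (T • s) = H¹([T] •) (comp s)` — `T` acts on `𝔖` as `conj_γ − 1` (`proj_X`),
`coresEisenstein` turns `conj_γ` into `(1+T)•` at the inverse extension (`κ̄⁻_J(γ) = −1`,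
`coresEisenstein_conjMap_of_layerIndex_eq_neg_one`), and `[T] = (1+T) − 1` acts as `H¹((1+T)•) − id`.
[cite: Howard2004HeegnerKolyvagin, §2.2 (Γ_K acts on Λ through γ ↦ 1 + T; 𝔖 → H¹(K, T_𝔮) is Λ-linear)]
[cite: Washington1997, §13.1–§13.2] -/
theorem eisensteinComponent_X_smul (hγ : κ.IsTopGenerator γ) (k n : ℕ) (hn : eisensteinLevel (p := p) hm k ≤ n) (s : D.S) :
    D.eisensteinComponent hm k n hn ((PowerSeries.X : IwasawaAlgebra p) • s) =
      galoisCohomology.map ((κ.unitTwist (-1)).eisensteinTwistSMulHom (V.torsionGaloisModule ((p : ℤ) ^ k)) hm k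
        (Ideal.Quotient.mk _ PowerSeries.X)) 1 (D.eisensteinComponent hm k n hn s) := by
  haveI := κ.fintypeQuotientLayer n
  have hX := congrFun (D.proj_X n s) k
  simp only [conjPi, AddMonoidHom.pi_apply, AddMonoidHom.coe_comp, Function.comp_apply,
    Pi.evalAddMonoidHom_apply, Pi.sub_apply] at hX
  rw [eisensteinComponent_apply, eisensteinComponent_apply, hX]
  erw [AddMonoidHom.map_sub]
  rw [V.conjH1_geomTorsion_eq_conjMap,
    (κ.unitTwist (-1)).coresEisenstein_conjMap_of_layerIndex_eq_neg_one (V.torsionGaloisModule ((p : ℤ) ^ k)) hm k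
      (κ.layerSubgroup n) (layerSubgroup_le_unitTwist_layerSubgroup hm hn) (κ.isOpen_layerSubgroup n)
      (κ.layerIndex_unitTwist_neg_one_of_isTopGenerator hγ _),
    ZpExtension.map_eisensteinTwistSMulHom_mk_X]

omit [V.IsElliptic] in
/-- **Constants**: `comp (C c • s) = H¹([C c] •) (comp s)` — `C c` acts on the `k`-th component of `proj n s` as the integer
`c mod p^k` (`proj_C`), and so does `[C c] ∈ A_{m,k}` on `H¹` (`map_eisensteinTwistSMulHom_mk_C`).
[cite: Howard2004HeegnerKolyvagin, §2.2] [cite: PerrinRiou1987BSMF, §0 p. 401] -/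
theorem eisensteinComponent_C_smul (k n : ℕ) (hn : eisensteinLevel (p := p) hm k ≤ n) (c : ℤ_[p]) (s : D.S) :
    D.eisensteinComponent hm k n hn (PowerSeries.C c • s) =
      galoisCohomology.map ((κ.unitTwist (-1)).eisensteinTwistSMulHom (V.torsionGaloisModule ((p : ℤ) ^ k)) hm k
        (Ideal.Quotient.mk _ (PowerSeries.C c))) 1 (D.eisensteinComponent hm k n hn s) := by
  haveI := κ.fintypeQuotientLayer n
  have hC := congrFun (D.proj_C n s c) k
  simp only [padicPi, AddMonoidHom.pi_apply, AddMonoidHom.coe_comp, Function.comp_apply,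
    Pi.evalAddMonoidHom_apply, zsmulAddGroupHom_apply] at hC
  rw [eisensteinComponent_apply, eisensteinComponent_apply, hC]
  erw [AddMonoidHom.map_zsmul]
  rw [ZpExtension.map_eisensteinTwistSMulHom_mk_C]

omit [V.IsElliptic] in
/-- **Continuity**: a power series without terms of degree `< k p^n` kills the level-`(n, k)` component (`proj_cont`).
[cite: PerrinRiou1987BSMF, §0 p. 402] [cite: Howard2004HeegnerKolyvagin, §2.2] -/
theorem eisensteinComponent_smul_eq_zero_of_forall_coeff_eq_zero (k n : ℕ) (hn : eisensteinLevel (p := p) hm k ≤ n)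
    (g : IwasawaAlgebra p) (hg : ∀ i < k * p ^ n, PowerSeries.coeff i g = 0) (s : D.S) :
    D.eisensteinComponent hm k n hn (g • s) = 0 := by
  haveI := κ.fintypeQuotientLayer n
  rw [eisensteinComponent_apply, D.proj_cont n k s g hg]
  exact map_zero _

omit [V.IsElliptic] in
/-- Powers of `T`: `comp (T^i • s) = H¹([T^i] •) (comp s)`. [cite: Howard2004HeegnerKolyvagin, §2.2] -/
theorem eisensteinComponent_X_pow_smul (hγ : κ.IsTopGenerator γ) (k n : ℕ) (hn : eisensteinLevel (p := p) hm k ≤ n)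
    (i : ℕ) (s : D.S) :
    D.eisensteinComponent hm k n hn ((PowerSeries.X : IwasawaAlgebra p) ^ i • s) =
      galoisCohomology.map ((κ.unitTwist (-1)).eisensteinTwistSMulHom (V.torsionGaloisModule ((p : ℤ) ^ k)) hm k
        (Ideal.Quotient.mk _ (PowerSeries.X ^ i))) 1 (D.eisensteinComponent hm k n hn s) := by
  induction i with
  | zero => rw [pow_zero, one_smul, map_one, ZpExtension.map_eisensteinTwistSMulHom_one]
  | succ i ih =>
    rw [pow_succ', mul_smul, D.eisensteinComponent_X_smul hm hγ, ih, map_mul,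
      ZpExtension.map_eisensteinTwistSMulHom_mul]

omit [V.IsElliptic] in
/-- **Polynomials**: `comp (P • s) = H¹([P] •) (comp s)` for `P ∈ ℤ_p[T] ⊆ Λ` (induction on `P` from the `T`- and `C`-cases).
[cite: Howard2004HeegnerKolyvagin, §2.2] -/
theorem eisensteinComponent_coe_smul (hγ : κ.IsTopGenerator γ) (k n : ℕ) (hn : eisensteinLevel (p := p) hm k ≤ n)
    (P : Polynomial ℤ_[p]) (s : D.S) :
    D.eisensteinComponent hm k n hn ((P : IwasawaAlgebra p) • s) =
      galoisCohomology.map ((κ.unitTwist (-1)).eisensteinTwistSMulHom (V.torsionGaloisModule ((p : ℤ) ^ k)) hm k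
        (Ideal.Quotient.mk _ (P : IwasawaAlgebra p))) 1 (D.eisensteinComponent hm k n hn s) := by
  induction P using Polynomial.induction_on' with
  | add P Q hP hQ =>
    rw [Polynomial.coe_add, add_smul, map_add, hP, hQ, map_add, ZpExtension.map_eisensteinTwistSMulHom_add]
  | monomial i c =>
    rw [← Polynomial.C_mul_X_pow_eq_monomial, Polynomial.coe_mul, Polynomial.coe_pow, Polynomial.coe_C,
      Polynomial.coe_X, mul_smul, D.eisensteinComponent_C_smul hm, D.eisensteinComponent_X_pow_smul hm hγ,
      ← ZpExtension.map_eisensteinTwistSMulHom_mul, ← map_mul]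

omit [NumberField K] [V.IsElliptic] in
/-- Truncation below `N`: `g − trunc_N g` has no terms of degree `< N`. [cite: Washington1997, §7.1] -/
theorem coeff_sub_trunc_eq_zero (g : IwasawaAlgebra p) (N i : ℕ) (hi : i < N) :
    PowerSeries.coeff i (g - ((PowerSeries.trunc N g : Polynomial ℤ_[p]) : IwasawaAlgebra p)) = 0 := by
  rw [map_sub, Polynomial.coeff_coe, PowerSeries.coeff_trunc, if_pos hi, sub_self]

omit [V.IsElliptic] in
/-- **Every `g ∈ Λ`**: `comp_{k,n} (g • s) = H¹([g] •) (comp_{k,n} s)` at every layer `n ≥ J_k` with `m ≤ p^n` — split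
`g = trunc_{kp^n} g + (g − trunc)`; the polynomial part is `eisensteinComponent_coe_smul`, the tail acts by `0` on `𝔖`'s
component (`proj_cont`) and by `0` on `H¹` (`X^{mk} ∣ tail`, `mk ≤ k p^n`). [cite: Howard2004HeegnerKolyvagin, §2.2 (𝔖 → H¹(K, T_𝔮) is a map of Λ-modules)]
[cite: PerrinRiou1987BSMF, §0 p. 402] -/
theorem eisensteinComponent_smul (hγ : κ.IsTopGenerator γ) (k n : ℕ) (hn : eisensteinLevel (p := p) hm k ≤ n)
    (hmn : m ≤ p ^ n) (g : IwasawaAlgebra p) (s : D.S) :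
    D.eisensteinComponent hm k n hn (g • s) =
      galoisCohomology.map ((κ.unitTwist (-1)).eisensteinTwistSMulHom (V.torsionGaloisModule ((p : ℤ) ^ k)) hm k
        (Ideal.Quotient.mk _ g)) 1 (D.eisensteinComponent hm k n hn s) := by
  set N := k * p ^ n with hN
  set r : IwasawaAlgebra p := g - ((PowerSeries.trunc N g : Polynomial ℤ_[p]) : IwasawaAlgebra p) with hr
  have hg : g = ((PowerSeries.trunc N g : Polynomial ℤ_[p]) : IwasawaAlgebra p) + r := by rw [hr, add_sub_cancel]
  have hr0 : ∀ i < k * p ^ n, PowerSeries.coeff i r = 0 := fun i hi ↦ coeff_sub_trunc_eq_zero g N i hi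
  have hr0' : ∀ i < m * k, PowerSeries.coeff i r = 0 := fun i hi ↦
    hr0 i (lt_of_lt_of_le hi (by rw [mul_comm]; exact Nat.mul_le_mul_left k hmn))
  conv_lhs => rw [hg, add_smul, map_add, D.eisensteinComponent_coe_smul hm hγ,
    D.eisensteinComponent_smul_eq_zero_of_forall_coeff_eq_zero hm k n hn r hr0, add_zero]
  conv_rhs => rw [hg, map_add, ZpExtension.map_eisensteinTwistSMulHom_add,
    (κ.unitTwist (-1)).map_eisensteinTwistSMulHom_mk_eq_zero_of_forall_coeff_eq_zero _ hm k r hr0', add_zero]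

/-! ## §2 The lift is `Λ`-linear -/

omit [NumberField K] [V.IsElliptic] in
/-- A layer above `J_k` with `m ≤ p^n`: `n = max J_k m` works (`m ≤ p^m`). [cite: Washington1997, §13.1] -/
theorem le_pow_max_eisensteinLevel (k : ℕ) : m ≤ p ^ max (eisensteinLevel (p := p) hm k) m :=
  (le_max_right _ _).trans (Nat.lt_pow_self hp.out.one_lt).le

section Linear

variable (t : ∀ k, (V.torsionGaloisModule ((p : ℤ) ^ (k + 1))).toContRepresentation →ⁱL
  (V.torsionGaloisModule ((p : ℤ) ^ k)).toContRepresentation)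
  (ht : ∀ k (P : geomTorsion V ((p : ℤ) ^ (k + 1))), t k P = V.geomTorsionReduce p k P)
  (I : ZpExtension.EisensteinH1Data (κ.unitTwist (-1)) (fun k ↦ V.torsionGaloisModule ((p : ℤ) ^ k)) t hm)

include ht

/-- **`Λ`-linearity of the compact control map**: `toEisensteinH1 (g • s) = g • toEisensteinH1 s` for every `g ∈ Λ`
(both sides have the same projections: `proj_toEisensteinH1` at a layer `n ≥ J_k` with `m ≤ p^n`, `eisensteinComponent_smul`,
and `EisensteinH1Data.proj_smul`). [cite: Howard2004HeegnerKolyvagin, §2.2, Lemma 2.2.7 and Prop. 2.2.8 (𝔖 → H¹(K, T_𝔮) is Λ-linear)] -/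
theorem toEisensteinH1_smul (hγ : κ.IsTopGenerator γ) (hE : ∀ P : V.toAffine.Point, p • P = 0 → P = 0)
    (g : IwasawaAlgebra p) (s : D.S) :
    D.toEisensteinH1 hm t ht I hγ hE (g • s) = g • D.toEisensteinH1 hm t ht I hγ hE s := by
  refine (I.ext_iff').2 fun k ↦ ?_
  have hn : eisensteinLevel (p := p) hm k ≤ max (eisensteinLevel (p := p) hm k) m := le_max_left _ _
  rw [I.proj_smul, D.proj_toEisensteinH1 hm t ht I hγ hE _ k hn, D.proj_toEisensteinH1 hm t ht I hγ hE _ k hn,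
    D.eisensteinComponent_smul hm hγ k _ hn (le_pow_max_eisensteinLevel (p := p) hm k) g s]

/-- **The compact control map `𝔖_p(K_∞) → H¹(K, T_𝔮)` as a `Λ`-LINEAR map** (Howard's `H¹(K, 𝐓) → H¹(K, T_𝔮)` induced by
`𝐓 → 𝐓 ⊗_Λ S_𝔮`, `𝔮 = (T^m + p)`, in the sign convention `κ⁻ = κ.unitTwist (-1)`): the additive lift `toEisensteinH1` with
`toEisensteinH1_smul`. Its restriction to Selmer parts is the field `f` of the cell's `SpecWitness`; the cokernel bound is
the content of Howard's Prop. 2.2.8 (not here). [cite: Howard2004HeegnerKolyvagin, §2.2, Def. 2.2.3, Lemma 2.2.7 and Prop. 2.2.8]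
[cite: MazurRubinMemoirs2004, §5.3] -/
def toEisensteinH1Linear (hγ : κ.IsTopGenerator γ) (hE : ∀ P : V.toAffine.Point, p • P = 0 → P = 0) :
    D.S →ₗ[IwasawaAlgebra p] I.H :=
  { D.toEisensteinH1 hm t ht I hγ hE with
    map_smul' := fun g s ↦ D.toEisensteinH1_smul hm t ht I hγ hE g s }

/-- `toEisensteinH1Linear` is `toEisensteinH1` on elements. [cite: Howard2004HeegnerKolyvagin, §2.2] -/
@[simp]
theorem toEisensteinH1Linear_apply (hγ : κ.IsTopGenerator γ) (hE : ∀ P : V.toAffine.Point, p • P = 0 → P = 0) (s : D.S) :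
    D.toEisensteinH1Linear hm t ht I hγ hE s = D.toEisensteinH1 hm t ht I hγ hE s :=
  rfl

/-- **`proj k ∘ f = cor_{Γ_n}^{Γ_K} ∘ (1 ⊗ ·) ∘ (proj_n · k)`** for the `Λ`-linear control map `f` and every layer `n ≥ J_k`.
[cite: Howard2004HeegnerKolyvagin, §2.2, Def. 2.2.3, Lemma 2.2.7 and Prop. 2.2.8] -/
theorem proj_toEisensteinH1Linear (hγ : κ.IsTopGenerator γ) (hE : ∀ P : V.toAffine.Point, p • P = 0 → P = 0)
    (s : D.S) (k : ℕ) {n : ℕ} (hn : eisensteinLevel (p := p) hm k ≤ n) :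
    I.proj k (D.toEisensteinH1Linear hm t ht I hγ hE s) = D.eisensteinComponent hm k n hn s :=
  D.proj_toEisensteinH1 hm t ht I hγ hE s k hn

end Linear

end WeierstrassCurve.LambdaAdicSelmerData

end
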